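import Summits.QuantumFields.QCD.Theses.TransparentRPWall
import Summits.QuantumFields.QCD.Theorems.TransparentRPWallLabelledConeChainDensity
import HarnessLib

/-!
# Route `TransparentRPWall` (QCD): the support item `LabelledConeChainDensity` (stmt-QuantumFields-18619) holds

By name: the route decl `TransparentRPWall.LabelledConeChainDensity` (piece X₂ = DENSITY of the crux-strategist split of
`LabelledPlanarSpectralCone`, stmt-QuantumFields-9910) is, verbatim, the inline statement proved as
`LabelledConeChainDensityProof.labelledConeChainDensity_proof` in `Theorems/TransparentRPWallLabelledConeChainDensity.lean`
(strategist-written, landed verbatim in four parts by width seat ym-t4-w17 g0).  No summit, leg or other crux statement is proved.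
-/

set_option autoImplicit false

namespace Summit.QuantumFields.QCD.Theorems

/-- **Item stmt-QuantumFields-18619 `TransparentRPWall.LabelledConeChainDensity` holds.** [folklore] -/
theorem transparentRPWall_labelledConeChainDensity_proof :
    Summit.QuantumFields.QCD.Theses.TransparentRPWall.LabelledConeChainDensity :=
  LabelledConeChainDensityProof.labelledConeChainDensity_proof

end Summit.QuantumFields.QCD.Theorems
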